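import Mathlib
import Summits.ValiantsHypothesis.ValiantsHypothesis.Theorems.KPlusLogSqLawStepEvents
import Summits.ValiantsHypothesis.ValiantsHypothesis.Theorems.KPlusLogSqLawStepPartner

/-!
# The FIVE-ROW SIGN LAW V, parity statements (static path model behind `KPlusLogSqLaw.TropicalB`)

Cell pub-symmetroid, seat conjb-2 (g22). A helper toward the crux `TropicalB`
(`Summit.ValiantsHypothesis.ValiantsHypothesis.Theses.KPlusLogSqLaw.TropicalB`, item
`stmt-ValiantsHypothesis-19771`); it earns no crux credit and is not evidence for `MatrixDescartes` or for
Valiant's hypothesis.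

LAW V (THEORY-NOTE-g22 §4bis, `KPlusLogSqLawStepEvents`): rows `i` and `i+4` step (each in either direction), rows
`i+1, i+2, i+3` move to the right (`T[i+1,·] < T[i+2,·] < T[i+3,·] < T[i+4,·]`), odd `d ≥ 3`. `five_row_even`: line
`i` even ⇒ `s (i+4) < s (i+d+1)`; `five_row_odd`: line `i` odd ⇒ `s (i+d+1) < s (i+4)` (by `S ↦ -S`, `sep_neg`).
Both are stated as the impossibility of the opposite strict inequality; at `d = 3` the two lines coincide and the
statements are empty. The left-moving mirror images follow by `θ ↦ -θ` and are not spelled out.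
-/

set_option linter.dupNamespace false

namespace Summit.ValiantsHypothesis.ValiantsHypothesis.Theorems.KPlusLogSqLawStepFive

open Summit.ValiantsHypothesis.ValiantsHypothesis.Theorems.KPlusLogSqLawStepEvents
  (leaving_event_right leaving_event_left entering_event_right entering_event_left five_row_core)
open Summit.ValiantsHypothesis.ValiantsHypothesis.Theorems.KPlusLogSqLawStepPartner (sep_neg sep_of_neg)

/-- FIVE-ROW SIGN LAW V, line `i` even: rows `i` and `i+4` step (either direction each), rows `i+1, i+2, i+3` move
to the right (`T[i+1,·] < T[i+2,·] < T[i+3,·] < T[i+4,·]`), odd `d ≥ 3`; then `s (i+4) < s (i+d+1)` (stated as: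
`s (i+d+1) < s (i+4)` is impossible; at `d = 3` the two lines coincide and the statement is empty). -/
theorem five_row_even (s b : ℕ → ℝ) (i d : ℕ) (hi : Even i) (hd : Odd d) (hd3 : 3 ≤ d)
    (hA0 : ∃ θ : ℝ, ∀ e o : ℕ, i ≤ e → e ≤ i + d → i ≤ o → o ≤ i + d → Even e → Odd o →
      b o + s o * θ < b e + s e * θ)
    (hA1 : ∃ θ : ℝ, ∀ e o : ℕ, i + 1 ≤ e → e ≤ i + d + 1 → i + 1 ≤ o → o ≤ i + d + 1 → Even e → Odd o →
      b o + s o * θ < b e + s e * θ)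
    (hord0 : (∀ θ θ' : ℝ, (∀ e o : ℕ, i ≤ e → e ≤ i + d → i ≤ o → o ≤ i + d → Even e → Odd o →
      b o + s o * θ < b e + s e * θ) → (∀ e o : ℕ, i + 1 ≤ e → e ≤ i + d + 1 → i + 1 ≤ o → o ≤ i + d + 1 →
      Even e → Odd o → b o + s o * θ' < b e + s e * θ') → θ < θ') ∨
      (∀ θ θ' : ℝ, (∀ e o : ℕ, i ≤ e → e ≤ i + d → i ≤ o → o ≤ i + d → Even e → Odd o →
      b o + s o * θ < b e + s e * θ) → (∀ e o : ℕ, i + 1 ≤ e → e ≤ i + d + 1 → i + 1 ≤ o → o ≤ i + d + 1 →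
      Even e → Odd o → b o + s o * θ' < b e + s e * θ') → θ' < θ))
    (hord1 : ∀ θ θ' : ℝ, (∀ e o : ℕ, i + 1 ≤ e → e ≤ i + d + 1 → i + 1 ≤ o → o ≤ i + d + 1 → Even e →
      Odd o → b o + s o * θ < b e + s e * θ) → (∀ e o : ℕ, i + 2 ≤ e → e ≤ i + d + 2 → i + 2 ≤ o →
      o ≤ i + d + 2 → Even e → Odd o → b o + s o * θ' < b e + s e * θ') → θ < θ')
    (hA2 : ∃ θ : ℝ, ∀ e o : ℕ, i + 2 ≤ e → e ≤ i + d + 2 → i + 2 ≤ o → o ≤ i + d + 2 → Even e → Odd o →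
      b o + s o * θ < b e + s e * θ)
    (hord2 : ∀ θ θ' : ℝ, (∀ e o : ℕ, i + 2 ≤ e → e ≤ i + d + 2 → i + 2 ≤ o → o ≤ i + d + 2 → Even e →
      Odd o → b o + s o * θ < b e + s e * θ) → (∀ e o : ℕ, i + 3 ≤ e → e ≤ i + d + 3 → i + 3 ≤ o →
      o ≤ i + d + 3 → Even e → Odd o → b o + s o * θ' < b e + s e * θ') → θ < θ')
    (hA3 : ∃ θ : ℝ, ∀ e o : ℕ, i + 3 ≤ e → e ≤ i + d + 3 → i + 3 ≤ o → o ≤ i + d + 3 → Even e → Odd o →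
      b o + s o * θ < b e + s e * θ)
    (hord3 : ∀ θ θ' : ℝ, (∀ e o : ℕ, i + 3 ≤ e → e ≤ i + d + 3 → i + 3 ≤ o → o ≤ i + d + 3 → Even e →
      Odd o → b o + s o * θ < b e + s e * θ) → (∀ e o : ℕ, i + 4 ≤ e → e ≤ i + d + 4 → i + 4 ≤ o →
      o ≤ i + d + 4 → Even e → Odd o → b o + s o * θ' < b e + s e * θ') → θ < θ')
    (hA4 : ∃ θ : ℝ, ∀ e o : ℕ, i + 4 ≤ e → e ≤ i + d + 4 → i + 4 ≤ o → o ≤ i + d + 4 → Even e → Odd o →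
      b o + s o * θ < b e + s e * θ)
    (hA5 : ∃ θ : ℝ, ∀ e o : ℕ, i + 5 ≤ e → e ≤ i + d + 5 → i + 5 ≤ o → o ≤ i + d + 5 → Even e → Odd o →
      b o + s o * θ < b e + s e * θ)
    (hord4 : (∀ θ θ' : ℝ, (∀ e o : ℕ, i + 4 ≤ e → e ≤ i + d + 4 → i + 4 ≤ o → o ≤ i + d + 4 → Even e →
      Odd o → b o + s o * θ < b e + s e * θ) → (∀ e o : ℕ, i + 5 ≤ e → e ≤ i + d + 5 → i + 5 ≤ o →
      o ≤ i + d + 5 → Even e → Odd o → b o + s o * θ' < b e + s e * θ') → θ < θ') ∨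
      (∀ θ θ' : ℝ, (∀ e o : ℕ, i + 4 ≤ e → e ≤ i + d + 4 → i + 4 ≤ o → o ≤ i + d + 4 → Even e →
      Odd o → b o + s o * θ < b e + s e * θ) → (∀ e o : ℕ, i + 5 ≤ e → e ≤ i + d + 5 → i + 5 ≤ o →
      o ≤ i + d + 5 → Even e → Odd o → b o + s o * θ' < b e + s e * θ') → θ' < θ))
    (hV : s (i + d + 1) < s (i + 4)) : False := by
  have hi1 : ¬ Even (i + 1) := by
    obtain ⟨k, hk⟩ := hi
    exact Nat.not_even_iff_odd.mpr ⟨k, by omega⟩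
  have hi5 : ¬ Even (i + 4 + 1) := by
    obtain ⟨k, hk⟩ := hi
    exact Nat.not_even_iff_odd.mpr ⟨k + 2, by omega⟩
  have hup1 : Even (i + d + 1) := by
    obtain ⟨k, hk⟩ := hi
    obtain ⟨l, hl⟩ := hd
    exact ⟨k + l + 1, by omega⟩
  have hup4 : Even (i + 4) := by
    obtain ⟨k, hk⟩ := hi
    exact ⟨k + 2, by omega⟩
  have hup5 : Even (i + 4 + d + 1) := by
    obtain ⟨k, hk⟩ := hi
    obtain ⟨l, hl⟩ := hd
    exact ⟨k + l + 3, by omega⟩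
  obtain ⟨θ0, hθ0⟩ := hA0
  obtain ⟨θ1, hθ1⟩ := hA1
  obtain ⟨θ4, hθ4⟩ := hA4
  obtain ⟨θ5, hθ5⟩ := hA5
  -- generic forms of the data of rows `i` and `i + 4`
  have gA0 : ∃ θ : ℝ, ∀ e o : ℕ, i ≤ e → e ≤ i + d → i ≤ o → o ≤ i + d → Even e → ¬ Even o →
      b o + s o * θ < b e + s e * θ :=
    ⟨θ0, fun e o h1 h2 h3 h4 he ho => hθ0 e o h1 h2 h3 h4 he (Nat.not_even_iff_odd.mp ho)⟩
  have gA1 : ∃ θ : ℝ, ∀ e o : ℕ, i + 1 ≤ e → e ≤ i + d + 1 → i + 1 ≤ o → o ≤ i + d + 1 → Even e → ¬ Even o →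
      b o + s o * θ < b e + s e * θ :=
    ⟨θ1, fun e o h1 h2 h3 h4 he ho => hθ1 e o h1 h2 h3 h4 he (Nat.not_even_iff_odd.mp ho)⟩
  have gA4 : ∃ θ : ℝ, ∀ e o : ℕ, i + 4 ≤ e → e ≤ i + 4 + d → i + 4 ≤ o → o ≤ i + 4 + d → Even e →
      ¬ Even o → b o + s o * θ < b e + s e * θ :=
    ⟨θ4, fun e o h1 h2 h3 h4 he ho => hθ4 e o h1 (by omega) h3 (by omega) he (Nat.not_even_iff_odd.mp ho)⟩
  have gA5 : ∃ θ : ℝ, ∀ e o : ℕ, i + 4 + 1 ≤ e → e ≤ i + 4 + d + 1 → i + 4 + 1 ≤ o → o ≤ i + 4 + d + 1 →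
      Even e → ¬ Even o → b o + s o * θ < b e + s e * θ :=
    ⟨θ5, fun e o h1 h2 h3 h4 he ho => hθ5 e o (by omega) (by omega) (by omega) (by omega) he
      (Nat.not_even_iff_odd.mp ho)⟩
  -- event A: the entering line `i + d + 1` of row `i`
  have hAev : ∃ A : ℝ, (∀ M : ℝ, (∀ θ : ℝ, (∀ e o : ℕ, i + 1 ≤ e → e ≤ i + d + 1 → i + 1 ≤ o →
      o ≤ i + d + 1 → Even e → Odd o → b o + s o * θ < b e + s e * θ) → θ < M) → A ≤ M) ∧
      b (i + d + 1) + s (i + d + 1) * A ≤ b (i + 4) + s (i + 4) * A := by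
    rcases hord0 with hR | hL
    · obtain ⟨A, hAle, hbot⟩ := entering_event_right (fun n => Even n) s b i d hi hup1
        ⟨i + 1, le_rfl, by omega, hi1⟩ gA0 gA1
        (fun θ θ' hθ hθ' => hR θ θ'
          (fun e o h1 h2 h3 h4 he ho => hθ e o h1 h2 h3 h4 he (Nat.not_even_iff_odd.mpr ho))
          (fun e o h1 h2 h3 h4 he ho => hθ' e o h1 h2 h3 h4 he (Nat.not_even_iff_odd.mpr ho)))
      exact ⟨A, fun M hM => hAle M (fun θ hθ => hM θ (fun e o h1 h2 h3 h4 he ho => hθ e o h1 h2 h3 h4 he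
        (Nat.not_even_iff_odd.mpr ho))), hbot (i + 4) (by omega) (by omega) hup4⟩
    · obtain ⟨A, hAle, hbot⟩ := entering_event_left (fun n => Even n) s b i d hi hup1
        ⟨i + 1, le_rfl, by omega, hi1⟩ gA0 gA1
        (fun θ θ' hθ hθ' => hL θ θ'
          (fun e o h1 h2 h3 h4 he ho => hθ e o h1 h2 h3 h4 he (Nat.not_even_iff_odd.mpr ho))
          (fun e o h1 h2 h3 h4 he ho => hθ' e o h1 h2 h3 h4 he (Nat.not_even_iff_odd.mpr ho)))
      exact ⟨A, fun M hM => hAle M (fun θ hθ => hM θ (fun e o h1 h2 h3 h4 he ho => hθ e o h1 h2 h3 h4 he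
        (Nat.not_even_iff_odd.mpr ho))), hbot (i + 4) (by omega) (by omega) hup4⟩
  -- event B: the leaving line `i + 4` of row `i + 4`
  have hBev : ∃ B : ℝ, (∀ m : ℝ, (∀ θ : ℝ, (∀ e o : ℕ, i + 4 ≤ e → e ≤ i + d + 4 → i + 4 ≤ o →
      o ≤ i + d + 4 → Even e → Odd o → b o + s o * θ < b e + s e * θ) → m < θ) → m ≤ B) ∧
      b (i + 4) + s (i + 4) * B ≤ b (i + d + 1) + s (i + d + 1) * B := by
    rcases hord4 with hR | hL
    · obtain ⟨B, hBge, hbot⟩ := leaving_event_right (fun n => Even n) s b (i + 4) d hup4 hup5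
        ⟨i + 4 + 1, le_rfl, by omega, hi5⟩ gA4 gA5
        (fun θ θ' hθ hθ' => hR θ θ'
          (fun e o h1 h2 h3 h4 he ho => hθ e o h1 (by omega) h3 (by omega) he (Nat.not_even_iff_odd.mpr ho))
          (fun e o h1 h2 h3 h4 he ho => hθ' e o (by omega) (by omega) (by omega) (by omega) he
            (Nat.not_even_iff_odd.mpr ho)))
      exact ⟨B, fun m hm => hBge m (fun θ hθ => hm θ (fun e o h1 h2 h3 h4 he ho => hθ e o h1 (by omega) h3
        (by omega) he (Nat.not_even_iff_odd.mpr ho))), hbot (i + d + 1) (by omega) (by omega) hup1⟩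
    · obtain ⟨B, hBge, hbot⟩ := leaving_event_left (fun n => Even n) s b (i + 4) d hup4 hup5
        ⟨i + 4 + 1, le_rfl, by omega, hi5⟩ gA4 gA5
        (fun θ θ' hθ hθ' => hL θ θ'
          (fun e o h1 h2 h3 h4 he ho => hθ e o h1 (by omega) h3 (by omega) he (Nat.not_even_iff_odd.mpr ho))
          (fun e o h1 h2 h3 h4 he ho => hθ' e o (by omega) (by omega) (by omega) (by omega) he
            (Nat.not_even_iff_odd.mpr ho)))
      exact ⟨B, fun m hm => hBge m (fun θ hθ => hm θ (fun e o h1 h2 h3 h4 he ho => hθ e o h1 (by omega) h3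
        (by omega) he (Nat.not_even_iff_odd.mpr ho))), hbot (i + d + 1) (by omega) (by omega) hup1⟩
  exact five_row_core s b (i + 4) (i + d + 1) _ _ _ _ hord1 hA2 hord2 hA3 hord3 hAev hBev hV

/-- FIVE-ROW SIGN LAW V, line `i` odd (classes swapped by `S ↦ -S`): same hypotheses, conclusion
`s (i+d+1) < s (i+4)` (stated as: `s (i+4) < s (i+d+1)` is impossible). -/
theorem five_row_odd (s b : ℕ → ℝ) (i d : ℕ) (hi : Odd i) (hd : Odd d) (hd3 : 3 ≤ d)
    (hA0 : ∃ θ : ℝ, ∀ e o : ℕ, i ≤ e → e ≤ i + d → i ≤ o → o ≤ i + d → Even e → Odd o →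
      b o + s o * θ < b e + s e * θ)
    (hA1 : ∃ θ : ℝ, ∀ e o : ℕ, i + 1 ≤ e → e ≤ i + d + 1 → i + 1 ≤ o → o ≤ i + d + 1 → Even e → Odd o →
      b o + s o * θ < b e + s e * θ)
    (hord0 : (∀ θ θ' : ℝ, (∀ e o : ℕ, i ≤ e → e ≤ i + d → i ≤ o → o ≤ i + d → Even e → Odd o →
      b o + s o * θ < b e + s e * θ) → (∀ e o : ℕ, i + 1 ≤ e → e ≤ i + d + 1 → i + 1 ≤ o → o ≤ i + d + 1 →
      Even e → Odd o → b o + s o * θ' < b e + s e * θ') → θ < θ') ∨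
      (∀ θ θ' : ℝ, (∀ e o : ℕ, i ≤ e → e ≤ i + d → i ≤ o → o ≤ i + d → Even e → Odd o →
      b o + s o * θ < b e + s e * θ) → (∀ e o : ℕ, i + 1 ≤ e → e ≤ i + d + 1 → i + 1 ≤ o → o ≤ i + d + 1 →
      Even e → Odd o → b o + s o * θ' < b e + s e * θ') → θ' < θ))
    (hord1 : ∀ θ θ' : ℝ, (∀ e o : ℕ, i + 1 ≤ e → e ≤ i + d + 1 → i + 1 ≤ o → o ≤ i + d + 1 → Even e →
      Odd o → b o + s o * θ < b e + s e * θ) → (∀ e o : ℕ, i + 2 ≤ e → e ≤ i + d + 2 → i + 2 ≤ o →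
      o ≤ i + d + 2 → Even e → Odd o → b o + s o * θ' < b e + s e * θ') → θ < θ')
    (hA2 : ∃ θ : ℝ, ∀ e o : ℕ, i + 2 ≤ e → e ≤ i + d + 2 → i + 2 ≤ o → o ≤ i + d + 2 → Even e → Odd o →
      b o + s o * θ < b e + s e * θ)
    (hord2 : ∀ θ θ' : ℝ, (∀ e o : ℕ, i + 2 ≤ e → e ≤ i + d + 2 → i + 2 ≤ o → o ≤ i + d + 2 → Even e →
      Odd o → b o + s o * θ < b e + s e * θ) → (∀ e o : ℕ, i + 3 ≤ e → e ≤ i + d + 3 → i + 3 ≤ o →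
      o ≤ i + d + 3 → Even e → Odd o → b o + s o * θ' < b e + s e * θ') → θ < θ')
    (hA3 : ∃ θ : ℝ, ∀ e o : ℕ, i + 3 ≤ e → e ≤ i + d + 3 → i + 3 ≤ o → o ≤ i + d + 3 → Even e → Odd o →
      b o + s o * θ < b e + s e * θ)
    (hord3 : ∀ θ θ' : ℝ, (∀ e o : ℕ, i + 3 ≤ e → e ≤ i + d + 3 → i + 3 ≤ o → o ≤ i + d + 3 → Even e →
      Odd o → b o + s o * θ < b e + s e * θ) → (∀ e o : ℕ, i + 4 ≤ e → e ≤ i + d + 4 → i + 4 ≤ o →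
      o ≤ i + d + 4 → Even e → Odd o → b o + s o * θ' < b e + s e * θ') → θ < θ')
    (hA4 : ∃ θ : ℝ, ∀ e o : ℕ, i + 4 ≤ e → e ≤ i + d + 4 → i + 4 ≤ o → o ≤ i + d + 4 → Even e → Odd o →
      b o + s o * θ < b e + s e * θ)
    (hA5 : ∃ θ : ℝ, ∀ e o : ℕ, i + 5 ≤ e → e ≤ i + d + 5 → i + 5 ≤ o → o ≤ i + d + 5 → Even e → Odd o →
      b o + s o * θ < b e + s e * θ)
    (hord4 : (∀ θ θ' : ℝ, (∀ e o : ℕ, i + 4 ≤ e → e ≤ i + d + 4 → i + 4 ≤ o → o ≤ i + d + 4 → Even e →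
      Odd o → b o + s o * θ < b e + s e * θ) → (∀ e o : ℕ, i + 5 ≤ e → e ≤ i + d + 5 → i + 5 ≤ o →
      o ≤ i + d + 5 → Even e → Odd o → b o + s o * θ' < b e + s e * θ') → θ < θ') ∨
      (∀ θ θ' : ℝ, (∀ e o : ℕ, i + 4 ≤ e → e ≤ i + d + 4 → i + 4 ≤ o → o ≤ i + d + 4 → Even e →
      Odd o → b o + s o * θ < b e + s e * θ) → (∀ e o : ℕ, i + 5 ≤ e → e ≤ i + d + 5 → i + 5 ≤ o →
      o ≤ i + d + 5 → Even e → Odd o → b o + s o * θ' < b e + s e * θ') → θ' < θ))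
    (hV : s (i + 4) < s (i + d + 1)) : False := by
  have hi1 : ¬ Odd (i + 1) := by
    obtain ⟨k, hk⟩ := hi
    exact Nat.not_odd_iff_even.mpr ⟨k + 1, by omega⟩
  have hi5 : ¬ Odd (i + 4 + 1) := by
    obtain ⟨k, hk⟩ := hi
    exact Nat.not_odd_iff_even.mpr ⟨k + 3, by omega⟩
  have hup1 : Odd (i + d + 1) := by
    obtain ⟨k, hk⟩ := hi
    obtain ⟨l, hl⟩ := hd
    exact ⟨k + l + 1, by omega⟩
  have hup4 : Odd (i + 4) := by
    obtain ⟨k, hk⟩ := hi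
    exact ⟨k + 2, by omega⟩
  have hup5 : Odd (i + 4 + d + 1) := by
    obtain ⟨k, hk⟩ := hi
    obtain ⟨l, hl⟩ := hd
    exact ⟨k + l + 3, by omega⟩
  obtain ⟨θ0, hθ0⟩ := hA0
  obtain ⟨θ1, hθ1⟩ := hA1
  obtain ⟨θ2, hθ2⟩ := hA2
  obtain ⟨θ3, hθ3⟩ := hA3
  obtain ⟨θ4, hθ4⟩ := hA4
  obtain ⟨θ5, hθ5⟩ := hA5
  -- negated lines `-S`: the odd class is on top; data of rows `i`, `i + 4` in generic form for `up = Odd`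
  have gA0 : ∃ θ : ℝ, ∀ e o : ℕ, i ≤ e → e ≤ i + d → i ≤ o → o ≤ i + d → Odd e → ¬ Odd o →
      -b o + -s o * θ < -b e + -s e * θ := ⟨θ0, sep_neg s b i (i + d) θ0 hθ0⟩
  have gA1 : ∃ θ : ℝ, ∀ e o : ℕ, i + 1 ≤ e → e ≤ i + d + 1 → i + 1 ≤ o → o ≤ i + d + 1 → Odd e → ¬ Odd o →
      -b o + -s o * θ < -b e + -s e * θ := ⟨θ1, sep_neg s b (i + 1) (i + d + 1) θ1 hθ1⟩
  have gA4 : ∃ θ : ℝ, ∀ e o : ℕ, i + 4 ≤ e → e ≤ i + 4 + d → i + 4 ≤ o → o ≤ i + 4 + d → Odd e → ¬ Odd o →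
      -b o + -s o * θ < -b e + -s e * θ :=
    ⟨θ4, fun e o h1 h2 h3 h4 he ho => sep_neg s b (i + 4) (i + d + 4) θ4 hθ4 e o h1 (by omega) h3 (by omega)
      he ho⟩
  have gA5 : ∃ θ : ℝ, ∀ e o : ℕ, i + 4 + 1 ≤ e → e ≤ i + 4 + d + 1 → i + 4 + 1 ≤ o → o ≤ i + 4 + d + 1 →
      Odd e → ¬ Odd o → -b o + -s o * θ < -b e + -s e * θ :=
    ⟨θ5, fun e o h1 h2 h3 h4 he ho => sep_neg s b (i + 5) (i + d + 5) θ5 hθ5 e o (by omega) (by omega)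
      (by omega) (by omega) he ho⟩
  have nA2 : ∃ θ : ℝ, ∀ e o : ℕ, i + 2 ≤ e → e ≤ i + d + 2 → i + 2 ≤ o → o ≤ i + d + 2 → Odd e → ¬ Odd o →
      -b o + -s o * θ < -b e + -s e * θ := ⟨θ2, sep_neg s b (i + 2) (i + d + 2) θ2 hθ2⟩
  have nA3 : ∃ θ : ℝ, ∀ e o : ℕ, i + 3 ≤ e → e ≤ i + d + 3 → i + 3 ≤ o → o ≤ i + d + 3 → Odd e → ¬ Odd o →
      -b o + -s o * θ < -b e + -s e * θ := ⟨θ3, sep_neg s b (i + 3) (i + d + 3) θ3 hθ3⟩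
  have nord1 : ∀ θ θ' : ℝ, (∀ e o : ℕ, i + 1 ≤ e → e ≤ i + d + 1 → i + 1 ≤ o → o ≤ i + d + 1 → Odd e →
      ¬ Odd o → -b o + -s o * θ < -b e + -s e * θ) → (∀ e o : ℕ, i + 2 ≤ e → e ≤ i + d + 2 → i + 2 ≤ o →
      o ≤ i + d + 2 → Odd e → ¬ Odd o → -b o + -s o * θ' < -b e + -s e * θ') → θ < θ' :=
    fun θ θ' hθ hθ' => hord1 θ θ' (sep_of_neg s b (i + 1) (i + d + 1) θ hθ)
      (sep_of_neg s b (i + 2) (i + d + 2) θ' hθ')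
  have nord2 : ∀ θ θ' : ℝ, (∀ e o : ℕ, i + 2 ≤ e → e ≤ i + d + 2 → i + 2 ≤ o → o ≤ i + d + 2 → Odd e →
      ¬ Odd o → -b o + -s o * θ < -b e + -s e * θ) → (∀ e o : ℕ, i + 3 ≤ e → e ≤ i + d + 3 → i + 3 ≤ o →
      o ≤ i + d + 3 → Odd e → ¬ Odd o → -b o + -s o * θ' < -b e + -s e * θ') → θ < θ' :=
    fun θ θ' hθ hθ' => hord2 θ θ' (sep_of_neg s b (i + 2) (i + d + 2) θ hθ)
      (sep_of_neg s b (i + 3) (i + d + 3) θ' hθ')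
  have nord3 : ∀ θ θ' : ℝ, (∀ e o : ℕ, i + 3 ≤ e → e ≤ i + d + 3 → i + 3 ≤ o → o ≤ i + d + 3 → Odd e →
      ¬ Odd o → -b o + -s o * θ < -b e + -s e * θ) → (∀ e o : ℕ, i + 4 ≤ e → e ≤ i + d + 4 → i + 4 ≤ o →
      o ≤ i + d + 4 → Odd e → ¬ Odd o → -b o + -s o * θ' < -b e + -s e * θ') → θ < θ' :=
    fun θ θ' hθ hθ' => hord3 θ θ' (sep_of_neg s b (i + 3) (i + d + 3) θ hθ)
      (sep_of_neg s b (i + 4) (i + d + 4) θ' hθ')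
  -- event A
  have hAev : ∃ A : ℝ, (∀ M : ℝ, (∀ θ : ℝ, (∀ e o : ℕ, i + 1 ≤ e → e ≤ i + d + 1 → i + 1 ≤ o →
      o ≤ i + d + 1 → Odd e → ¬ Odd o → -b o + -s o * θ < -b e + -s e * θ) → θ < M) → A ≤ M) ∧
      -b (i + d + 1) + -s (i + d + 1) * A ≤ -b (i + 4) + -s (i + 4) * A := by
    rcases hord0 with hR | hL
    · obtain ⟨A, hAle, hbot⟩ := entering_event_right (fun n => Odd n) (fun t => -s t) (fun t => -b t) i d hi
        hup1 ⟨i + 1, le_rfl, by omega, hi1⟩ gA0 gA1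
        (fun θ θ' hθ hθ' => hR θ θ' (sep_of_neg s b i (i + d) θ hθ) (sep_of_neg s b (i + 1) (i + d + 1) θ' hθ'))
      exact ⟨A, hAle, hbot (i + 4) (by omega) (by omega) hup4⟩
    · obtain ⟨A, hAle, hbot⟩ := entering_event_left (fun n => Odd n) (fun t => -s t) (fun t => -b t) i d hi
        hup1 ⟨i + 1, le_rfl, by omega, hi1⟩ gA0 gA1
        (fun θ θ' hθ hθ' => hL θ θ' (sep_of_neg s b i (i + d) θ hθ) (sep_of_neg s b (i + 1) (i + d + 1) θ' hθ'))
      exact ⟨A, hAle, hbot (i + 4) (by omega) (by omega) hup4⟩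
  -- event B
  have hBev : ∃ B : ℝ, (∀ m : ℝ, (∀ θ : ℝ, (∀ e o : ℕ, i + 4 ≤ e → e ≤ i + d + 4 → i + 4 ≤ o →
      o ≤ i + d + 4 → Odd e → ¬ Odd o → -b o + -s o * θ < -b e + -s e * θ) → m < θ) → m ≤ B) ∧
      -b (i + 4) + -s (i + 4) * B ≤ -b (i + d + 1) + -s (i + d + 1) * B := by
    rcases hord4 with hR | hL
    · obtain ⟨B, hBge, hbot⟩ := leaving_event_right (fun n => Odd n) (fun t => -s t) (fun t => -b t) (i + 4) d
        hup4 hup5 ⟨i + 4 + 1, le_rfl, by omega, hi5⟩ gA4 gA5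
        (fun θ θ' hθ hθ' => hR θ θ'
          (sep_of_neg s b (i + 4) (i + d + 4) θ (fun e o h1 h2 h3 h4 he ho => hθ e o h1 (by omega) h3
            (by omega) he ho))
          (sep_of_neg s b (i + 5) (i + d + 5) θ' (fun e o h1 h2 h3 h4 he ho => hθ' e o (by omega) (by omega)
            (by omega) (by omega) he ho)))
      exact ⟨B, fun m hm => hBge m (fun θ hθ => hm θ (fun e o h1 h2 h3 h4 he ho => hθ e o h1 (by omega) h3
        (by omega) he ho)), hbot (i + d + 1) (by omega) (by omega) hup1⟩
    · obtain ⟨B, hBge, hbot⟩ := leaving_event_left (fun n => Odd n) (fun t => -s t) (fun t => -b t) (i + 4) d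
        hup4 hup5 ⟨i + 4 + 1, le_rfl, by omega, hi5⟩ gA4 gA5
        (fun θ θ' hθ hθ' => hL θ θ'
          (sep_of_neg s b (i + 4) (i + d + 4) θ (fun e o h1 h2 h3 h4 he ho => hθ e o h1 (by omega) h3
            (by omega) he ho))
          (sep_of_neg s b (i + 5) (i + d + 5) θ' (fun e o h1 h2 h3 h4 he ho => hθ' e o (by omega) (by omega)
            (by omega) (by omega) he ho)))
      exact ⟨B, fun m hm => hBge m (fun θ hθ => hm θ (fun e o h1 h2 h3 h4 he ho => hθ e o h1 (by omega) h3
        (by omega) he ho)), hbot (i + d + 1) (by omega) (by omega) hup1⟩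
  exact five_row_core (fun t => -s t) (fun t => -b t) (i + 4) (i + d + 1) _ _ _ _ nord1 nA2 nord2 nA3 nord3
    hAev hBev (by show -s (i + d + 1) < -s (i + 4); linarith)

end Summit.ValiantsHypothesis.ValiantsHypothesis.Theorems.KPlusLogSqLawStepFive
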